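import Mathlib
import HarnessLib
import Summits.HubbardSuperconductivity.HubbardSuperconductivity.Theorems.KLProgrammeKLRegimeTwoVolumeLipDoubledDoorData
import Summits.HubbardSuperconductivity.HubbardSuperconductivity.Theorems.KLProgrammeKLRegimeTwoVolumeLipBlockStepDeepRate

/-!
# Route `KLProgramme` — crux K3 ENGINE (stmt-HubbardSuperconductivity-20437), stub (e) proof-input «(e)-D-ROWS», keying (A′), REKEY-D file D2′:
# THE DEEP BLOCK-STEP DOOR OF THE DOUBLED TOWER AT GENERIC INPUTS (the glued coarse input `V` and the difference `D` abstracted)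
# (seat hubbard-kl-k3c4-p1 g28; the text of ✓ D2 `…TwoVolumeLipDoubledBlockStepDeep.lipBlockStepD_deep_rate_le` with `V`, `D` free even constant-free elements — needed by the
#  SOURCE-TRUNCATED tower of `…TwoVolumeLipDoubledTruncDefs`, which runs the same door at `V = klGlueD (klLipInputDT L)`, `D = klLipInputDiffDT`; `--supports` 23356)

* **`lipBlockStepD_deep_rate_le_of`** — hypotheses: `V, D` even with zero constant part; the SECTOR covariance data (`κ`, weighted rows `α` of `klLipCov (bL)`), weighted profiles
  `NV` of `V` and `ND` of `D`, a free deep-pin majorant `E` of `D`, smallness `θ₁ θ₂`, truncation `N₀`, transfer data of `klLipTransfer (bL)` (`a ≥ 1`, `τ ≥ 0`), plain-pin partner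
  fact `hW`, zone constant `Λ`; conclusion: the pinned kernel sum of `map T⁺(born⁺(V + D) − born⁺ V)` at `(i, w″)` is at most the displayed door bound (same right-hand side as D2).

Composition of landed theorems (proof = D2's, minus the model parity lines); nothing asserts the (D) rows, (e), VL, K3 or superconductivity.
References: BGM 2006 §2.7 (2.70)–(2.71), §3 (3.2)–(3.8) [cite: BenfattoGiulianiMastropietro2006]; Salmhofer 1998 §4.1.
-/

noncomputable section

namespace Summit.HubbardSuperconductivity.HubbardSuperconductivity.Theorems.TwoVolumeLip

set_option linter.dupNamespace false -- summit = problem name (single-conjunct summit), D-0017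

open Finset Literature.MathematicalPhysics.QuantumLattice GrassmannAlgebra Literature.Probability.LatticeModels
open Literature.MathematicalPhysics.QuantumLattice.FermiRG
open Summit.HubbardSuperconductivity.HubbardSuperconductivity.Theorems.KLRegimeSplit
open Summit.HubbardSuperconductivity.HubbardSuperconductivity.Theorems.KLProgrammeLegKernels
open Summit.HubbardSuperconductivity.HubbardSuperconductivity.Theorems.EngineV8
open Summit.HubbardSuperconductivity.HubbardSuperconductivity.Theorems.TwoVolumeSource
open Summit.HubbardSuperconductivity.HubbardSuperconductivity.Theorems.TwoVolumeDefect


/-! ## D2′ THE DEEP BLOCK-STEP DOOR AT GENERIC INPUTS -/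

section DoorDGeneric

open Literature.Probability.LatticeModels.BattleFederbush

variable {L b M : ℕ} [NeZero L] [NeZero (b * L)] [NeZero M]
set_option maxHeartbeats 400000 in
/-- **THE DEEP BLOCK-STEP DOOR OF THE DOUBLED TOWER AT GENERIC EVEN, CONSTANT-FREE INPUTS `V`, `D`** on the doubled labels of block `k` (fine torus `bL`, coarse `L`, common
frame `K`, glued weight at any rate `j_w` read through `Prod.fst`, deep region `klDeepPinsD L R`, near columns `Near` read on the position-sector component and `(R+R′)`-deep,
admissible zone constant `0 < Λ ≤ 1 + Λ_{j_w}(R′+1)`, transfer columns `≤ a` with `1 ≤ a`; at a PLAIN pin (`w″.2 = 1`) the pin's partner column is `Near`): the generic door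
`TwoVolumeDefect.sum_pinned_norm_kernel_map_born_sub_born_le_of_deep` at `(f, C, g) = (id, klLipCovD, toLin' klLipTransferD)` — ✓ D2 `lipBlockStepD_deep_rate_le` with the glued
coarse input and the input difference ABSTRACTED (D2 is the instance `V = klGlueD (klLipInputD L)`, `D = klLipInputDiffD`; the truncated tower reads `V = klGlueD (klLipInputDT L)`,
`D = klLipInputDiffDT`). [cite: BenfattoGiulianiMastropietro2006, §2.7 (2.70)-(2.71), §3 (3.2)-(3.8)] -/
theorem lipBlockStepD_deep_rate_le_of {β : ℝ} (hβ : 0 < β) (μ : ℝ) (K : TrigPolyC4v) {d k jw : ℕ}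
    (V D : GrassmannAlgebra ℂ (SrcLabel (b * L) M (d * k - 1)))
    (hVe : V ∈ evenOdd ℂ 0) (hV0 : constPart ℂ V = 0) (hDe : D ∈ evenOdd ℂ 0) (hD0 : constPart ℂ D = 0)
    {κ : ℝ} (hκ : 0 < κ) (hGB : IsGramBoundedR (klLipCov (b * L) M β μ K d k) κ)
    (NV ND E : ℕ → ℝ) (hNV0 : ∀ m', 0 ≤ NV m') (hND0 : ∀ m', 0 ≤ ND m') (hE0 : ∀ m', 0 ≤ E m')
    (hNV : ∀ m' (j : Fin (2 * m')) (x : SrcLabel (b * L) M (d * k - 1)), ∑ Y ∈ univ.filter (fun Y : Fin (2 * m') → SrcLabel (b * L) M (d * k - 1) => Y j = x),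
      ‖kernel ℂ (V) (2 * m') Y‖ *
        klGluedWt L b M β jw (sectorCount (d * k - 1)) ((univ.image Y).image Prod.fst) ≤ NV m')
    (hND : ∀ m' (j : Fin (2 * m')) (x : SrcLabel (b * L) M (d * k - 1)), ∑ Y ∈ univ.filter (fun Y : Fin (2 * m') → SrcLabel (b * L) M (d * k - 1) => Y j = x),
      ‖kernel ℂ (D) (2 * m') Y‖ * klGluedWt L b M β jw (sectorCount (d * k - 1)) ((univ.image Y).image Prod.fst) ≤ ND m')
    (R R' : ℕ)
    (hE : ∀ m' (j : Fin (2 * m')) (x : SrcLabel (b * L) M (d * k - 1)), x ∈ klDeepPinsD (V := b * L) (M := M) (n := d * k - 1) L R →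
      ∑ Y ∈ univ.filter (fun Y : Fin (2 * m') → SrcLabel (b * L) M (d * k - 1) => Y j = x), ‖kernel ℂ (D) (2 * m') Y‖ ≤ E m')
    {α : ℝ} (hα : 0 < α)
    (hrow : ∀ X, ∑ Y, ‖klLipCov (b * L) M β μ K d k X Y‖ * klGluedWt L b M β jw (sectorCount (d * k - 1)) {X, Y} ≤ α)
    (hcol : ∀ Y, ∑ X, ‖klLipCov (b * L) M β μ K d k X Y‖ * klGluedWt L b M β jw (sectorCount (d * k - 1)) {X, Y} ≤ α)
    {ρ : ℝ} (hρ : 0 < ρ)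
    (hθ₁ : Real.exp 1 * α * normV (SrcLabel (b * L) M (d * k - 1)) κ ρ (fun m' => NV m' + ND m' + E m') / κ ^ 2 < 1)
    (hθ₂ : Real.exp 1 * α * normV (SrcLabel (b * L) M (d * k - 1)) κ ρ (fun m' => NV m' + ND m') / κ ^ 2 < 1)
    {N₀ : ℕ} (hN₀ : 2 ≤ N₀)
    (Near : (SpaceTimeIdx (b * L) M × SectorLeg (sectorCount (d * k - 1))) → Prop) [DecidablePred Near] (hNear : ∀ y', Near y' → y' ∈ klDeepPins L (R + R'))
    {a τ : ℝ} (ha1 : 1 ≤ a) (hτ0 : 0 ≤ τ)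
    (hcolH : ∀ y', ∑ x'', ‖klLipTransfer (b * L) M β μ K d k x'' y'‖ ≤ a) (w'' : SrcLabel (b * L) M (d * k))
    (hrowH : ∑ y' ∈ univ.filter (fun y' => Near y'), ‖klLipTransfer (b * L) M β μ K d k w''.1 y'‖ ≤ a)
    (hτH : ∑ y' ∈ univ.filter (fun y' => ¬ Near y'), ‖klLipTransfer (b * L) M β μ K d k w''.1 y'‖ ≤ τ)
    (hW : w''.2 = 1 → ∀ y, klPlainShift (b * L) M (sectorCount (d * k)) (sectorCount (d * k - 1)) w''.1 y ≠ 0 → Near y)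
    {Λ : ℝ} (hΛ0 : 0 < Λ) (hΛle : Λ ≤ 1 + klScale klE0 jw * ((R' : ℝ) + 1))
    {q : ℕ} (i : Fin (2 * q)) :
    ∑ X'' ∈ univ.filter (fun X'' : Fin (2 * q) → SrcLabel (b * L) M (d * k) => X'' i = w''),
        ‖kernel ℂ (ExteriorAlgebra.map (Matrix.toLin' (klLipTransferD (b * L) M β μ K d k))
          ((effAction ℂ (klLipCovD (b * L) M β μ K d k)
                (V + D) -
              (V + D)) -
            (effAction ℂ (klLipCovD (b * L) M β μ K d k) (V) -
              V))) (2 * q) X''‖ ≤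
      a ^ (2 * q - 1) * (a *
        ((∑ m' ∈ range (Fintype.card (SrcLabel (b * L) M (d * k - 1)) / 2 + 1), if q < m' then ((2 * m').choose (2 * q) : ℝ) * κ ^ (2 * m' - 2 * q) * E m' else 0) +
          Λ⁻¹ * ∑ m' ∈ range (Fintype.card (SrcLabel (b * L) M (d * k - 1)) / 2 + 1),
            if q < m' then ((2 * m').choose (2 * q) : ℝ) * κ ^ (2 * m' - 2 * q) * ND m' else 0) +
        τ * ∑ m' ∈ range (Fintype.card (SrcLabel (b * L) M (d * k - 1)) / 2 + 1), if q < m' then ((2 * m').choose (2 * q) : ℝ) * κ ^ (2 * m' - 2 * q) * ND m' else 0) +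
      a ^ (2 * q - 1) * (a *
        ((∑ n ∈ Ico 2 N₀, (ρ⁻¹ ^ (2 * q) * κ⁻¹ ^ (2 * (n - 1)) * (α ^ (n - 1) * Real.exp n)) *
            ∑ δ ∈ (Fintype.piFinset fun _ : Fin n => range (Fintype.card (SrcLabel (b * L) M (d * k - 1)) / 2 + 1)) with 2 * q + 2 * (n - 1) ≤ ∑ a, 2 * δ a,
              ∑ a, (Real.exp 2 * (κ + ρ)) ^ (2 * δ a) * E (δ a) *
                ∏ b ∈ univ.erase a, (Real.exp 2 * (κ + ρ)) ^ (2 * δ b) * (NV (δ b) + ND (δ b) + E (δ b)) +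
          2 * (ρ⁻¹ ^ (2 * q) * (Real.exp 1 * normV (SrcLabel (b * L) M (d * k - 1)) κ ρ (fun m' => NV m' + ND m' + E m')) *
            (Real.exp 1 * α * normV (SrcLabel (b * L) M (d * k - 1)) κ ρ (fun m' => NV m' + ND m' + E m') / κ ^ 2) ^ (N₀ - 1) /
              (1 - Real.exp 1 * α * normV (SrcLabel (b * L) M (d * k - 1)) κ ρ (fun m' => NV m' + ND m' + E m') / κ ^ 2))) +
        Λ⁻¹ * (∑ n ∈ Ico 2 N₀, (ρ⁻¹ ^ (2 * q) * κ⁻¹ ^ (2 * (n - 1)) * (α ^ (n - 1) * Real.exp n)) *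
            ∑ δ ∈ (Fintype.piFinset fun _ : Fin n => range (Fintype.card (SrcLabel (b * L) M (d * k - 1)) / 2 + 1)) with 2 * q + 2 * (n - 1) ≤ ∑ a, 2 * δ a,
              ∑ a, (Real.exp 2 * (κ + ρ)) ^ (2 * δ a) * ND (δ a) *
                ∏ b ∈ univ.erase a, (Real.exp 2 * (κ + ρ)) ^ (2 * δ b) * (NV (δ b) + ND (δ b)) +
          Λ * (2 * (ρ⁻¹ ^ (2 * q) * (Real.exp 1 * normV (SrcLabel (b * L) M (d * k - 1)) κ ρ (fun m' => NV m' + ND m')) *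
            (Real.exp 1 * α * normV (SrcLabel (b * L) M (d * k - 1)) κ ρ (fun m' => NV m' + ND m') / κ ^ 2) ^ (N₀ - 1) /
              (1 - Real.exp 1 * α * normV (SrcLabel (b * L) M (d * k - 1)) κ ρ (fun m' => NV m' + ND m') / κ ^ 2))))) +
        τ * (∑ n ∈ Ico 2 N₀, (ρ⁻¹ ^ (2 * q) * κ⁻¹ ^ (2 * (n - 1)) * (α ^ (n - 1) * Real.exp n)) *
            ∑ δ ∈ (Fintype.piFinset fun _ : Fin n => range (Fintype.card (SrcLabel (b * L) M (d * k - 1)) / 2 + 1)) with 2 * q + 2 * (n - 1) ≤ ∑ a, 2 * δ a,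
              ∑ a, (Real.exp 2 * (κ + ρ)) ^ (2 * δ a) * ND (δ a) *
                ∏ b ∈ univ.erase a, (Real.exp 2 * (κ + ρ)) ^ (2 * δ b) * (NV (δ b) + ND (δ b)) +
          2 * (ρ⁻¹ ^ (2 * q) * (Real.exp 1 * normV (SrcLabel (b * L) M (d * k - 1)) κ ρ (fun m' => NV m' + ND m')) *
            (Real.exp 1 * α * normV (SrcLabel (b * L) M (d * k - 1)) κ ρ (fun m' => NV m' + ND m') / κ ^ 2) ^ (N₀ - 1) /
              (1 - Real.exp 1 * α * normV (SrcLabel (b * L) M (d * k - 1)) κ ρ (fun m' => NV m' + ND m') / κ ^ 2)))) := by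
  classical
  have h10 : ¬ ((1 : Fin 2) = 0) := by decide
  -- the weight read through `Prod.fst`
  set wt : Finset (SrcLabel (b * L) M (d * k - 1)) → ℝ := fun S => klGluedWt L b M β jw (sectorCount (d * k - 1)) (S.image Prod.fst) with hwt_def
  have hwt : IsTreeWeight wt := (isTreeWeight_klGluedWt (L := L) (b := b) (M := M) hβ.le jw (sectorCount (d * k - 1))).comap Prod.fst
  have hΛ : ∀ y' : SrcLabel (b * L) M (d * k - 1), Near y'.1 → ∀ Sset : Finset (SrcLabel (b * L) M (d * k - 1)), y' ∈ Sset →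
      (∃ z ∈ Sset, ¬ z ∈ klDeepPinsD (V := b * L) (M := M) (n := d * k - 1) L R) → Λ ≤ wt Sset := by
    intro y' hy' Sset hyS hz
    obtain ⟨z, hzS, hzR⟩ := hz
    rw [mem_klDeepPinsD] at hzR
    exact hΛle.trans (klGluedWt_ge_of_deep_of_not_deep hβ.le jw (Finset.mem_image_of_mem _ hyS) (Finset.mem_image_of_mem _ hzS) (hNear _ hy') hzR)
  -- the substitutions: `f = id`, `g = toLin' T⁺`
  set f : (SrcLabel (b * L) M (d * k - 1) → ℂ) →ₗ[ℂ] (SrcLabel (b * L) M (d * k - 1) → ℂ) := LinearMap.id with hf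
  set g : (SrcLabel (b * L) M (d * k - 1) → ℂ) →ₗ[ℂ] (SrcLabel (b * L) M (d * k) → ℂ) := Matrix.toLin' (klLipTransferD (b * L) M β μ K d k) with hg
  have hfm : LinearMap.toMatrix' f = 1 := by rw [hf, LinearMap.toMatrix'_id]
  have hfCf : (LinearMap.toMatrix' f).transpose * klLipCovD (b * L) M β μ K d k * LinearMap.toMatrix' f = klLipCovD (b * L) M β μ K d k := by
    rw [hfm, Matrix.transpose_one, Matrix.one_mul, Matrix.mul_one]
  have hgf : LinearMap.toMatrix' (g ∘ₗ f) = klLipTransferD (b * L) M β μ K d k := by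
    rw [hf, LinearMap.comp_id, hg, LinearMap.toMatrix'_toLin']
  -- data in the doubled reading
  have hGBD : IsGramBoundedR ((LinearMap.toMatrix' f).transpose * klLipCovD (b * L) M β μ K d k * LinearMap.toMatrix' f) κ := by
    rw [hfCf]; exact isGramBoundedR_klLipCovD hGB
  have hrowD : ∀ X : SrcLabel (b * L) M (d * k - 1), ∑ Y, ‖((LinearMap.toMatrix' f).transpose * klLipCovD (b * L) M β μ K d k * LinearMap.toMatrix' f) X Y‖ * wt {X, Y} ≤ α := by
    intro X; rw [hfCf]
    exact rowSum_spectator_wt_le _ _ hα.le hrow _ (klLipCovD_apply β μ K d k) X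
  have hcolD : ∀ Y : SrcLabel (b * L) M (d * k - 1), ∑ X, ‖((LinearMap.toMatrix' f).transpose * klLipCovD (b * L) M β μ K d k * LinearMap.toMatrix' f) X Y‖ * wt {X, Y} ≤ α := by
    intro Y; rw [hfCf]
    exact colSum_spectator_wt_le _ _ hα.le hcol _ (klLipCovD_apply β μ K d k) Y
  have hcolHD : ∀ y' : SrcLabel (b * L) M (d * k - 1), ∑ x'', ‖LinearMap.toMatrix' (g ∘ₗ f) x'' y'‖ ≤ a := by
    intro y'; rw [hgf]
    exact colSum_doubleBlock_le _ _ _ (klLipTransferD_apply β μ K d k) hcolH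
      (colSum_norm_klPlainShift_le_one (sectorCount_pos _)) ha1 y'
  have hrowHD : ∑ y' ∈ univ.filter (fun y' : SrcLabel (b * L) M (d * k - 1) => Near y'.1), ‖LinearMap.toMatrix' (g ∘ₗ f) w'' y'‖ ≤ a := by
    rw [hgf]
    rcases Fin.exists_fin_two.1 ⟨w''.2, rfl⟩ with h | h
    · rw [rowSum_doubleBlock_filter_copy0 _ _ _ (klLipTransferD_apply β μ K d k) Near w'' h]; exact hrowH
    · exact (rowSum_doubleBlock_filter_copy1_le _ _ _ (klLipTransferD_apply β μ K d k)
        (fun x s => rowSum_norm_klPlainShift_le_one (sectorCount_pos _) x s) _ w'' h).trans ha1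
  have hτHD : ∑ y' ∈ univ.filter (fun y' : SrcLabel (b * L) M (d * k - 1) => ¬ Near y'.1), ‖LinearMap.toMatrix' (g ∘ₗ f) w'' y'‖ ≤ τ := by
    rw [hgf]
    rcases Fin.exists_fin_two.1 ⟨w''.2, rfl⟩ with h | h
    · rw [rowSum_doubleBlock_filter_copy0 _ _ _ (klLipTransferD_apply β μ K d k) (fun y => ¬ Near y) w'' h]; exact hτH
    · refine le_trans (le_of_eq (Finset.sum_eq_zero fun y' hy' => ?_)) hτ0
      rw [Finset.mem_filter] at hy'
      rw [klLipTransferD_apply, h]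
      simp only [h10, false_and, if_false, true_and]
      by_cases hy2 : y'.2 = 1
      · rw [if_pos hy2]
        by_contra hne
        exact hy'.2 (hW h y'.1 (fun h0 => hne (by rw [h0, norm_zero])))
      · rw [if_neg hy2, norm_zero]
  have h := sum_pinned_norm_kernel_map_born_sub_born_le_of_deep hwt (klLipCovD (b * L) M β μ K d k) f g hκ hGBD
    (V) (D) hVe hDe hV0 hD0 NV ND E hNV0 hND0 hE0
    (fun m' j x => by simpa [hwt_def, Finset.image_image] using hNV m' j x) (fun m' j x => by simpa [hwt_def, Finset.image_image] using hND m' j x)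
    (fun x : SrcLabel (b * L) M (d * k - 1) => x ∈ klDeepPinsD (V := b * L) (M := M) (n := d * k - 1) L R) (fun m' j x hx => hE m' j x hx) hα hrowD hcolD hρ hθ₁ hθ₂ hN₀
    (fun y' : SrcLabel (b * L) M (d * k - 1) => Near y'.1) (a := a) (τ := τ) (le_trans zero_le_one ha1) hcolHD w'' hrowHD hτHD hΛ0 hΛ i
  simpa only [hf, ExteriorAlgebra.map_id, AlgHom.id_apply] using h

end DoorDGeneric

end Summit.HubbardSuperconductivity.HubbardSuperconductivity.Theorems.TwoVolumeLip

end
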